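import Summits.Langlands.Langlands.Theses.G2ShadowRankSeven
import Summits.Langlands.Langlands.Theorems.IrreducibilityBySelfDualityIrreducibleOffSectorTransfer
import Summits.Langlands.Langlands.Theorems.RamifiedCoefficientSeedSectorComplementJunctionOfR
import Summits.Langlands.Langlands.Theorems.G2ShadowRankSevenAssembly
import HarnessLib

/-!
# `G2ShadowRankSeven.RankSevenToLanglands` is the summit modulo the route target, and is sandwiched by
# item `ReciprocityUpToIrreducibilityR` (stmt-Langlands-17925) granted Jacquet–Shalika (2.2)–(2.3) —
# item-level certificate
(support item stmt-Langlands-18291 of route `G2ShadowRankSeven`, rank 9, declared RESIDUAL by the planner;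
`--supports` file: no `sorry`, no definition, axioms `propext` / `Classical.choice` / `Quot.sound`; imports the
route module, landed Theorems modules and, through them, Literature.)

`RankSevenToLanglands := RankSevenCofinite → _root_.Langlands` is the D-0027 frame item of the route ("the honest
rest of the summit along this line": everything that the route target `X = RankSevenCofinite` — cofinite-in-`ℓ`
irreducibility of the `ℓ`-adic avatars of regular L-algebraic cuspidal `π` on `GL₇(𝔸_ℚ)` essentially self-dual at
Satake level — does not claim: the exceptional `ℓ`, all other `n`, all number fields, irregular / non-polarised
`π`, local–global compatibility at every place, direction (B)).  Nothing in print proves it (it contains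
Buzzard–Gee 2014 Conj. 3.2.1/3.2.2 and Fontaine–Mazur–Langlands for every `n` over every number field); this
file does not (cannot) settle it.  It records, as kernel facts on the texts of EXISTING items, exactly where the
item sits:

* `rankSevenCofinite_of_langlands` — **`Langlands → RankSevenCofinite`** (tightness of the frame): `X` is
  already in the summit's L-normalisation (`SatakeFrobCompatibleAt`, `arithFrobPolyOfSatake ι q_v 1 α`), so
  clause (A) of the summit in rank 7 over `ℚ` (for any reciprocity datum, which exists by the non-vacuity
  conjunct) gives an IRREDUCIBLE avatar `ρ₀` of `π`, and irreducibility transfers to every a.e.-compatible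
  `ρ` by Chebotarev + Brauer–Nesbitt (landed `IrreducibleOffSector.isIrreducible_of_satakeFrobCompatible`);
  regularity, essential self-duality and the exceptional set (`S = ∅`) are idle;
* `langlands_iff_rankSevenCofinite_and_rankSevenToLanglands` — `Langlands ↔ RankSevenCofinite ∧
  RankSevenToLanglands`, and `not_rankSevenToLanglands_iff` — `¬ RankSevenToLanglands ↔ RankSevenCofinite ∧
  ¬ Langlands`: refuting the item = proving the route target AND refuting the audited summit;
* `langlands_iff_rankSevenToLanglands_of_cruxes` — under the three cruxes the item IS the summit (the route's
  weight dichotomy `A → B → C → X` is the landed `G2ShadowRankSeven.rankSevenCofinite_of_cells` of the Assembly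
  file, reused, not restated);
* `rankSevenToLanglands_of_reciprocityUpToIrreducibilityR_text_of_JS` — SUFFICIENCY: the item follows from
  the text R of item stmt-Langlands-17925 (`IrreducibilityBySelfDuality.ReciprocityUpToIrreducibilityR`:
  reciprocity up to irreducibility for EVERY pinned reciprocity datum + the non-vacuity conjunct; written out
  verbatim because the decl lives in another route's Theses module) and the Literature named facts
  `JacquetShalika1981_partialPairL_boundary_repData` / `…_pole_repData` (Arthur–Clozel (2.2)–(2.3) = items
  stmt-Langlands-13622 / stmt-Langlands-19093), the antecedent `X` DISCARDED — via the landed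
  `RamifiedCoefficientSeedJunctionOfR.langlands_of_reciprocityUpToIrreducibilityR_text_of_JS` (isobaric
  bootstrap for irreducibility, Chebotarev + Brauer–Nesbitt for uniqueness up to conjugacy);
* `reciprocityUpToIrreducibilityR_text_of_rankSevenToLanglands` — NECESSITY under the target: `X ∧` item
  `⇒ Langlands ⇒ R`;
* `rankSevenToLanglands_iff_rankSevenCofinite_imp_reciprocityUpToIrreducibilityR_text` — under JS,
  **`RankSevenToLanglands ↔ (RankSevenCofinite → R)`**; and under JS and `X`, item `↔ R`.

So the item's open content is exactly item stmt-Langlands-17925 (plus the two Jacquet–Shalika formalisation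
debts).  Pattern adapted from the landed certificates `Theorems/ExteriorSquareAscentRestOfReciprocityOfR.lean`
and `Theorems/RamifiedCoefficientSeedSectorComplementJunctionOfR.lean` of the sibling frame items.

References: K. Buzzard, T. Gee, LMS LNS 414 (2014), Conj. 3.2.1–3.2.2 [BuzzardGeeLMS2014]; J.-M. Fontaine,
B. Mazur (1995), Conj. 1 [FontaineMazurGeometric1995]; D. Ramakrishnan, *Irreducibility and cuspidality*
(2008) §0 [arXiv:math/0609460]; J. Arthur, L. Clozel, Ann. Math. Stud. 120, Ch. 3 §2 (2.2)–(2.3)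
[ArthurClozelAMS120]; P. Deligne, J.-P. Serre, ASENS 7 (1974), Lemme 3.2 [DeligneSerreASENS1974].
-/

noncomputable section

open scoped NumberField Classical Polynomial
open Filter IsDedekindDomain
open Literature.NumberTheory.Automorphic Literature.NumberTheory.GaloisRepresentations
open Summit.Langlands
open Summit.Langlands.Langlands.Theses.G2ShadowRankSeven (RankSevenCofinite RankSevenToLanglands
  NoShadowLineAdmissible LineOrIrreducibleAdmissible GenericWeightCofinite)
open Summit.Langlands.Langlands.Theorems.IrreducibleOffSector

namespace Summit.Langlands.Langlands.Theorems.RankSevenToLanglandsOfR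

/-! ## 1. Tightness of the frame: `Langlands → RankSevenCofinite` -/

/-- **`Langlands → RankSevenCofinite`** (tightness of the frame item: `RankSevenToLanglands := RankSevenCofinite →
Langlands` can fail only together with the audited summit).  Given the summit and the data of `X` — `π` cuspidal on
`GL₇(𝔸_ℚ)` with an L-algebraic infinity type `T`, and `ρ : Γ_ℚ → GL₇(ℚ̄_ℓ)` Satake–Frobenius compatible with `(π, ι)`
at almost all places in the summit's own L-normalisation — clause (A) of the summit (any reciprocity datum, which
exists by the non-vacuity conjunct) gives an IRREDUCIBLE avatar `ρ₀` of `π`, and irreducibility transfers to `ρ` by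
Chebotarev + Brauer–Nesbitt (`IrreducibleOffSector.isIrreducible_of_satakeFrobCompatible`).  Regularity, essential
self-duality and the exceptional set are idle (`S = ∅`). [cite: BuzzardGeeLMS2014, Conj. 3.2.1]
[cite: DeligneSerreASENS1974, Lemme 3.2] -/
theorem rankSevenCofinite_of_langlands (hLang : _root_.Langlands) : RankSevenCofinite := by
  intro hcpt π T hT _hreg hLalg _hsd
  refine ⟨∅, fun ℓ _ _ ι ρ hρ => ?_⟩
  -- a reciprocity datum (non-vacuity conjunct) and clause (A) of the summit in rank 7 over `ℚ`
  obtain ⟨⟨𝓡⟩, hGLC⟩ := hLang ℚ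
  obtain ⟨hA, -⟩ := hGLC 𝓡 7 (by norm_num) hcpt
  obtain ⟨ρ₀, hirr₀, -, hcorr₀, -⟩ := hA π ⟨T, hT, hLalg⟩ ℓ ι
  exact isIrreducible_of_satakeFrobCompatible π.1 ι hirr₀ hcorr₀.1 hρ

/-- **The summit gives the item outright** (discard the antecedent). [folklore] -/
theorem rankSevenToLanglands_of_langlands (hLang : _root_.Langlands) : RankSevenToLanglands :=
  fun _ => hLang

/-- **`Langlands ↔ RankSevenCofinite ∧ RankSevenToLanglands`**: the frame item is EXACTLY the summit modulo the
route's target. [cite: BuzzardGeeLMS2014, Conj. 3.2.1 and Conj. 3.2.2] -/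
theorem langlands_iff_rankSevenCofinite_and_rankSevenToLanglands :
    _root_.Langlands ↔ RankSevenCofinite ∧ RankSevenToLanglands :=
  ⟨fun h => ⟨rankSevenCofinite_of_langlands h, rankSevenToLanglands_of_langlands h⟩, fun h => h.2 h.1⟩

/-- **`¬ RankSevenToLanglands ↔ RankSevenCofinite ∧ ¬ Langlands`**: refuting the item means proving the route
target AND refuting the audited summit. [folklore] -/
theorem not_rankSevenToLanglands_iff : ¬ RankSevenToLanglands ↔ RankSevenCofinite ∧ ¬ _root_.Langlands := by
  constructor
  · intro h
    by_contra h'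
    exact h fun hX => by_contra fun hL => h' ⟨hX, hL⟩
  · rintro ⟨hX, hL⟩ h
    exact hL (h hX)

/-- **Under the route target, the item IS the summit.** [folklore] -/
theorem rankSevenToLanglands_iff_langlands_of_target (hX : RankSevenCofinite) :
    RankSevenToLanglands ↔ _root_.Langlands :=
  ⟨fun h => h hX, rankSevenToLanglands_of_langlands⟩

/-! ## 2. Under the three cruxes (weight dichotomy, landed `rankSevenCofinite_of_cells`) the item is the summit -/

/-- **Under the three cruxes, the item IS the summit**: `RankSevenToLanglands ↔ Langlands` granted
`NoShadowLineAdmissible`, `LineOrIrreducibleAdmissible`, `GenericWeightCofinite`. [folklore] -/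
theorem langlands_iff_rankSevenToLanglands_of_cruxes (hA : NoShadowLineAdmissible)
    (hB : LineOrIrreducibleAdmissible) (hC : GenericWeightCofinite) :
    RankSevenToLanglands ↔ _root_.Langlands :=
  rankSevenToLanglands_iff_langlands_of_target (G2ShadowRankSeven.rankSevenCofinite_of_cells hA hB hC)

/-! ## 3. The item sandwiched by item stmt-Langlands-17925 under Arthur–Clozel (2.2)–(2.3) -/

/-- **SUFFICIENCY — the item from R and JS (2.2)–(2.3), the antecedent `X` DISCARDED**: `RankSevenToLanglands`
follows from the texts of items stmt-Langlands-17925 (R: reciprocity up to irreducibility for every pinned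
reciprocity datum, with the non-vacuity conjunct), stmt-Langlands-13622 and stmt-Langlands-19093 (the
Jacquet–Shalika named facts).  `X = RankSevenCofinite` is inert: irreducibility in clause (A) is free given
(A') + (B) + JS (isobaric bootstrap), and R asks for no irreducibility that `X` could supply.
[cite: BuzzardGeeLMS2014, Conj. 3.2.1 and Conj. 3.2.2] [cite: ArthurClozelAMS120, Ch. 3 §2 (2.2)–(2.3)] -/
theorem rankSevenToLanglands_of_reciprocityUpToIrreducibilityR_text_of_JS
    (h22 : JacquetShalika1981_partialPairL_boundary_repData) (h23 : JacquetShalika1981_partialPairL_pole_repData)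
    (hR : ∀ (F : Type) [Field F] [NumberField F], Nonempty (ReciprocityData F) ∧ ∀ (Rec : ReciprocityData F) (n : ℕ), 0 < n → ∀ hcpt : Literature.NumberTheory.Automorphic.isCompact_glFiniteIntegralLevel n F, (∀ π : Literature.NumberTheory.Automorphic.CuspidalAutomorphicRepData n F hcpt, π.1.IsLAlgebraic → ∀ (ℓ : ℕ) [Fact ℓ.Prime] (ι : PadicAlgCl ℓ ≃+* ℂ), ∃ ρ : Literature.NumberTheory.GaloisRepresentations.FramedGaloisRep F (PadicAlgCl ℓ) n, IsGeometricFramed Rec ρ ∧ Corresponds Rec ι π.1 ρ) ∧ GaloisToAutomorphic n Rec hcpt) :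
    RankSevenToLanglands :=
  fun _ => RamifiedCoefficientSeedJunctionOfR.langlands_of_reciprocityUpToIrreducibilityR_text_of_JS h22 h23 hR

/-- **NECESSITY under the route target**: granted `X = RankSevenCofinite` (assembled from the three cruxes,
`G2ShadowRankSeven.rankSevenCofinite_of_cells`), the item yields the summit and hence the text of item stmt-Langlands-17925 — the
item cannot close before that item once `X` holds. [folklore] -/
theorem reciprocityUpToIrreducibilityR_text_of_rankSevenToLanglands (hX : RankSevenCofinite)
    (h : RankSevenToLanglands) :
    ∀ (F : Type) [Field F] [NumberField F], Nonempty (ReciprocityData F) ∧ ∀ (Rec : ReciprocityData F) (n : ℕ), 0 < n → ∀ hcpt : Literature.NumberTheory.Automorphic.isCompact_glFiniteIntegralLevel n F, (∀ π : Literature.NumberTheory.Automorphic.CuspidalAutomorphicRepData n F hcpt, π.1.IsLAlgebraic → ∀ (ℓ : ℕ) [Fact ℓ.Prime] (ι : PadicAlgCl ℓ ≃+* ℂ), ∃ ρ : Literature.NumberTheory.GaloisRepresentations.FramedGaloisRep F (PadicAlgCl ℓ) n, IsGeometricFramed Rec ρ ∧ Corresponds Rec ι π.1 ρ) ∧ GaloisToAutomorphic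 n Rec hcpt :=
  RamifiedCoefficientSeedJunctionOfR.reciprocityUpToIrreducibilityR_text_of_langlands (h hX)

/-- **Under JS (2.2)–(2.3), `RankSevenToLanglands ↔ (RankSevenCofinite → R)`**: the item IS "the target implies
reciprocity up to irreducibility for every pinned datum" — and since R asks for no irreducibility, `X` is inert
in it. [cite: BuzzardGeeLMS2014, Conj. 3.2.1 and Conj. 3.2.2] [cite: ArthurClozelAMS120, Ch. 3 §2 (2.2)–(2.3)] -/
theorem rankSevenToLanglands_iff_rankSevenCofinite_imp_reciprocityUpToIrreducibilityR_text
    (h22 : JacquetShalika1981_partialPairL_boundary_repData) (h23 : JacquetShalika1981_partialPairL_pole_repData) :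
    RankSevenToLanglands ↔ (RankSevenCofinite →
      ∀ (F : Type) [Field F] [NumberField F], Nonempty (ReciprocityData F) ∧ ∀ (Rec : ReciprocityData F) (n : ℕ), 0 < n → ∀ hcpt : Literature.NumberTheory.Automorphic.isCompact_glFiniteIntegralLevel n F, (∀ π : Literature.NumberTheory.Automorphic.CuspidalAutomorphicRepData n F hcpt, π.1.IsLAlgebraic → ∀ (ℓ : ℕ) [Fact ℓ.Prime] (ι : PadicAlgCl ℓ ≃+* ℂ), ∃ ρ : Literature.NumberTheory.GaloisRepresentations.FramedGaloisRep F (PadicAlgCl ℓ) n, IsGeometricFramed Rec ρ ∧ Corresponds Rec ι π.1 ρ) ∧ GaloisToAutomorphic n Rec hcpt) :=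
  ⟨fun h hX => reciprocityUpToIrreducibilityR_text_of_rankSevenToLanglands hX h,
    fun h hX => RamifiedCoefficientSeedJunctionOfR.langlands_of_reciprocityUpToIrreducibilityR_text_of_JS h22 h23 (h hX)⟩

/-- **Under JS (2.2)–(2.3) and the route target, the item is EQUIVALENT to the text of item stmt-Langlands-17925**
(sufficiency + necessity): the frame's open content is exactly reciprocity up to irreducibility for every pinned
reciprocity datum. [cite: BuzzardGeeLMS2014, Conj. 3.2.1 and Conj. 3.2.2] [cite: ArthurClozelAMS120, Ch. 3 §2 (2.2)–(2.3)] -/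
theorem rankSevenToLanglands_iff_reciprocityUpToIrreducibilityR_text
    (h22 : JacquetShalika1981_partialPairL_boundary_repData) (h23 : JacquetShalika1981_partialPairL_pole_repData)
    (hX : RankSevenCofinite) :
    RankSevenToLanglands ↔
      ∀ (F : Type) [Field F] [NumberField F], Nonempty (ReciprocityData F) ∧ ∀ (Rec : ReciprocityData F) (n : ℕ), 0 < n → ∀ hcpt : Literature.NumberTheory.Automorphic.isCompact_glFiniteIntegralLevel n F, (∀ π : Literature.NumberTheory.Automorphic.CuspidalAutomorphicRepData n F hcpt, π.1.IsLAlgebraic → ∀ (ℓ : ℕ) [Fact ℓ.Prime] (ι : PadicAlgCl ℓ ≃+* ℂ), ∃ ρ : Literature.NumberTheory.GaloisRepresentations.FramedGaloisRep F (PadicAlgCl ℓ) n, IsGeometricFramed Rec ρ ∧ Corresponds Rec ι π.1 ρ) ∧ GaloisToAutomorphic n Rec hcpt :=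
  ⟨reciprocityUpToIrreducibilityR_text_of_rankSevenToLanglands hX,
    rankSevenToLanglands_of_reciprocityUpToIrreducibilityR_text_of_JS h22 h23⟩

/-- **… and under JS and the three cruxes** (target assembled by the landed `G2ShadowRankSeven.rankSevenCofinite_of_cells`), item `↔` R.
[cite: BuzzardGeeLMS2014, Conj. 3.2.1 and Conj. 3.2.2] [cite: ArthurClozelAMS120, Ch. 3 §2 (2.2)–(2.3)] -/
theorem rankSevenToLanglands_iff_reciprocityUpToIrreducibilityR_text_of_cruxes
    (h22 : JacquetShalika1981_partialPairL_boundary_repData) (h23 : JacquetShalika1981_partialPairL_pole_repData)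
    (hA : NoShadowLineAdmissible) (hB : LineOrIrreducibleAdmissible) (hC : GenericWeightCofinite) :
    RankSevenToLanglands ↔
      ∀ (F : Type) [Field F] [NumberField F], Nonempty (ReciprocityData F) ∧ ∀ (Rec : ReciprocityData F) (n : ℕ), 0 < n → ∀ hcpt : Literature.NumberTheory.Automorphic.isCompact_glFiniteIntegralLevel n F, (∀ π : Literature.NumberTheory.Automorphic.CuspidalAutomorphicRepData n F hcpt, π.1.IsLAlgebraic → ∀ (ℓ : ℕ) [Fact ℓ.Prime] (ι : PadicAlgCl ℓ ≃+* ℂ), ∃ ρ : Literature.NumberTheory.GaloisRepresentations.FramedGaloisRep F (PadicAlgCl ℓ) n, IsGeometricFramed Rec ρ ∧ Corresponds Rec ι π.1 ρ) ∧ GaloisToAutomorphic n Rec hcpt :=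
  rankSevenToLanglands_iff_reciprocityUpToIrreducibilityR_text h22 h23 (G2ShadowRankSeven.rankSevenCofinite_of_cells hA hB hC)

end Summit.Langlands.Langlands.Theorems.RankSevenToLanglandsOfR

end
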